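import Mathlib
import Summits.Ventures.HodgeRepro.Tier4.Line4.ProjectedTestList
import Summits.Ventures.HodgeRepro.Tier4.Line4.W3OfRieszType
import Summits.Ventures.HodgeRepro.Tier4.Common.PlaceCommute

/-!
# Tier4/Line4/StabilityOfProjected — the `(τ′,K)`-projected test function on `G(𝔸_k)` and the STABILITY clauses
(b″) of the re-typed L4 wall: `R(f̄₁) φ`, `R(f₂ˇ) φ` land in `kTypeSpace'` for the natural pair

Blind re-derivation cell `pub-hodge-repro`, Tier 4 «prove the step» (README §9–§10), seat t4-L4-p2 (prover, LINE L4,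
gen 3; plan-4's cut C-L4-PROJ S13921 / S13948 — the test-function side, third and last module). Tree path
`lean/Summits/Ventures/HodgeRepro/Tier4/Line4/StabilityOfProjected.lean`. Mathlib-level; no literature. Inputs: this
seat's `Line4/ProjectedTestList` (the composite bi-projector `biProjList`), t4-L4-p1's
`Line4/W3OfRieszType.rightRegular_mem_kTypeSpace'`, typer-2's `Common/PlaceCommute` (the local tori of `T′` at distinct
places commute, and commute with every subgroup of the finite part).

* `weightChar' W q g g' eP' eM' w κ := weightAt' … 0 κ ^ eP' w · weightAt' … 1 κ ^ eM' w` — the `T′`-weight at `w`;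
* `projData ν K νK` — the data `(localTorusAt' W w, ν w, conj ∘ weightChar' w)` over ALL infinite places (`Finset.univ`)
  followed by `(K, νK, 1)`; `projTest ν K νK f := biProjList (projData …) f` — **the `(τ′,K)`-projected test function**
  `e_{τ′,K} ⋆ f ⋆ e_{τ̄′,K}`;
* `pairwise_projData` (commutation, by `PlaceCommute`), `good_projData` (every datum good, from the DISPLAYED per-place
  inputs: compactness of `localTorusAt' W w`, a finite left-invariant `ν w`, continuity / multiplicativity / unit
  modulus of the weight on the torus — typer-2's RowWeights on the row planes, CompactHaarProbability for `ν`), `isTestFn_projTest`;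
* `projTest_apply_inv_mul` / `projTest_apply_mul` / the `K`-versions: the equivariances of `projTest f` at every place
  and at the level;
* **`rightRegular_cj_projTest_mem`** and **`rightRegular_refl_projTest_mem`**: for every invariant subspace `V` of the
  setting and `φ ∈ V`, `R(cj (projTest f)) φ ∈ kTypeSpace' W q g g' eP' eM' K V` and
  `R(refl (projTest f')) φ ∈ kTypeSpace' … K V` — the stability clauses `hst₁`, `hst₂` of plan-4's C-L4-2VEC
  (S13948) for the pair `f₁ := projTest f`, `f₂ := projTest f'` (with `V := span ℂ (τ (n j))`), for ANY two test
  functions `f`, `f'`.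
What stays of (b″) after this module: nothing — the shape of the pair is a theorem; the residual of the re-typed wall is
the closed adapted ONB (tree), `hadm` for the hit constituent and `hJ : Jc (f₁ ⋆ f₂) ≠ 0` for a pair of THIS class.

Nothing here says anything about the status of the Hodge conjecture for CM abelian varieties, which is NOT proved
(HC_CM is NOT proved by anyone in this repository).
-/

set_option autoImplicit false

noncomputable section

namespace Summit.Ventures.HodgeRepro.Tier4.Line4

open Summit.Ventures.HodgeRepro.Tier4.Common Summit.Ventures.HodgeRepro.Tier4.Line1 MeasureTheory NumberField
open scoped ComplexConjugate

section Data

variable {k : Type} [Field k] [NumberField k] (W : PlaneData k) [MeasurableSpace (GA W)]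
  (q : QuadData k) (g g' : Matrix (Fin 4) (Fin 4) k) (eP' eM' : InfinitePlace k → ℤ)

/-- The `T′`-weight character at the infinite place `w`. -/
def weightChar' (w : InfinitePlace k) (κ : GA W) : ℂ :=
  weightAt' W q w g g' 0 κ ^ eP' w * weightAt' W q w g g' 1 κ ^ eM' w

/-- The projection datum at `w`: the local torus of `T′`, the measure `ν w`, the CONJUGATE weight. -/
def placeDatum (ν : ∀ w : InfinitePlace k, Measure (localTorusAt' W w)) (w : InfinitePlace k) : ProjDatum (GA W) :=
  ⟨localTorusAt' W w, ν w, fun κ => conj (weightChar' W q g g' eP' eM' w κ)⟩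

/-- The projection datum of the level `K` (trivial character). -/
def levelDatum (K : Subgroup (GA W)) (νK : Measure K) : ProjDatum (GA W) := ⟨K, νK, fun _ => 1⟩

/-- **The data of the `(τ′,K)`-projector**: every infinite place, then the level. -/
def projData (ν : ∀ w : InfinitePlace k, Measure (localTorusAt' W w)) (K : Subgroup (GA W)) (νK : Measure K) :
    List (ProjDatum (GA W)) :=
  (Finset.univ : Finset (InfinitePlace k)).toList.map (placeDatum W q g g' eP' eM' ν) ++ [levelDatum W K νK]

/-- **The `(τ′,K)`-projected test function** `e ⋆ f ⋆ e`. -/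
def projTest (ν : ∀ w : InfinitePlace k, Measure (localTorusAt' W w)) (K : Subgroup (GA W)) (νK : Measure K)
    (f : GA W → ℂ) : GA W → ℂ :=
  biProjList (projData W q g g' eP' eM' ν K νK) f

/-- The datum at `w` belongs to the data. -/
theorem placeDatum_mem (ν : ∀ w : InfinitePlace k, Measure (localTorusAt' W w)) (K : Subgroup (GA W))
    (νK : Measure K) (w : InfinitePlace k) :
    placeDatum W q g g' eP' eM' ν w ∈ projData W q g g' eP' eM' ν K νK :=
  List.mem_append_left _ (List.mem_map.2 ⟨w, Finset.mem_toList.2 (Finset.mem_univ w), rfl⟩)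

/-- The datum of the level belongs to the data. -/
theorem levelDatum_mem (ν : ∀ w : InfinitePlace k, Measure (localTorusAt' W w)) (K : Subgroup (GA W))
    (νK : Measure K) : levelDatum W K νK ∈ projData W q g g' eP' eM' ν K νK :=
  List.mem_append_right _ (List.mem_singleton.2 rfl)

/-- **The data commute pairwise** (distinct places: `localTorusAt'_commute_of_ne`; a place and the level:
`localTorusAt'_commute_of_le_finitePart`). -/
theorem pairwise_projData (ν : ∀ w : InfinitePlace k, Measure (localTorusAt' W w)) (K : Subgroup (GA W))
    (hK : K ≤ finitePart W) (νK : Measure K) :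
    (projData W q g g' eP' eM' ν K νK).Pairwise ProjDatum.Commutes := by
  refine List.pairwise_append.2 ⟨?_, List.pairwise_singleton _ _, ?_⟩
  · rw [List.pairwise_map]
    refine (Finset.nodup_toList _).imp ?_
    intro w w' hww' a ha b hb
    exact localTorusAt'_commute_of_ne W hww' a ha b hb
  · intro d hd d' hd'
    obtain ⟨w, -, rfl⟩ := List.mem_map.1 hd
    rw [List.mem_singleton.1 hd']
    intro a ha b hb
    exact localTorusAt'_commute_of_le_finitePart W w hK a ha b hb

/-- **Every datum is good**, from the displayed per-place inputs and the level's. -/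
theorem good_projData (ν : ∀ w : InfinitePlace k, Measure (localTorusAt' W w)) (K : Subgroup (GA W))
    (νK : Measure K) (hcompT : ∀ w, IsCompact (localTorusAt' W w : Set (GA W)))
    (hfinT : ∀ w, IsFiniteMeasure (ν w)) (hinvT : ∀ w, (ν w).IsMulLeftInvariant)
    (hcont : ∀ w, Continuous fun κ : localTorusAt' W w => weightChar' W q g g' eP' eM' w κ)
    (hmul : ∀ w, ∀ a ∈ localTorusAt' W w, ∀ b ∈ localTorusAt' W w,
      weightChar' W q g g' eP' eM' w (a * b) = weightChar' W q g g' eP' eM' w a * weightChar' W q g g' eP' eM' w b)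
    (hunit : ∀ w, ∀ a ∈ localTorusAt' W w, ‖weightChar' W q g g' eP' eM' w a‖ = 1)
    (hKc : IsCompact (K : Set (GA W))) (hfinK : IsFiniteMeasure νK) (hinvK : νK.IsMulLeftInvariant) :
    ∀ d ∈ projData W q g g' eP' eM' ν K νK, d.Good := by
  intro d hd
  rcases List.mem_append.1 hd with hd | hd
  · obtain ⟨w, -, rfl⟩ := List.mem_map.1 hd
    exact ⟨hcompT w, hfinT w, hinvT w, Complex.continuous_conj.comp (hcont w),
      fun a ha b hb => by simp only [placeDatum]; rw [hmul w a ha b hb, map_mul],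
      fun a ha => by simp only [placeDatum]; rw [Complex.norm_conj]; exact hunit w a ha⟩
  · rw [List.mem_singleton.1 hd]
    exact ⟨hKc, hfinK, hinvK, continuous_const, fun _ _ _ _ => by simp [levelDatum],
      fun _ _ => by simp [levelDatum]⟩

end Data

section Stability

variable {k : Type} [Field k] [NumberField k] (W : PlaneData k) [MeasurableSpace (GA W)] [BorelSpace (GA W)]
  (q : QuadData k) (g g' : Matrix (Fin 4) (Fin 4) k) (eP' eM' : InfinitePlace k → ℤ)
  (ν : ∀ w : InfinitePlace k, Measure (localTorusAt' W w)) (K : Subgroup (GA W)) (νK : Measure K)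

/-- The projected test function of a test function is a test function. -/
theorem isTestFn_projTest (hgood : ∀ d ∈ projData W q g g' eP' eM' ν K νK, d.Good) {f : GA W → ℂ}
    (hf : IsTestFn W f) :
    IsTestFn W (projTest W q g g' eP' eM' ν K νK f) := by
  haveI := locallyCompact_GA W
  haveI := secondCountable_GA W
  have h := isTest_biProjList (projData W q g g' eP' eM' ν K νK) hgood (⟨hf.1, hf.2⟩ : RTF.IsTest f)
  exact ⟨h.cont, h.compact⟩

/-- Left-equivariance at `w` (inverse form, CONJUGATE weight): `f₁ (κ⁻¹ y) = conj (weight′ κ) · f₁ y`. -/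
theorem projTest_apply_inv_mul (hgood : ∀ d ∈ projData W q g g' eP' eM' ν K νK, d.Good)
    (hcomm : (projData W q g g' eP' eM' ν K νK).Pairwise ProjDatum.Commutes) (f : GA W → ℂ) (w : InfinitePlace k)
    (y : GA W) {κ : GA W} (hκ : κ ∈ localTorusAt' W w) :
    projTest W q g g' eP' eM' ν K νK f (κ⁻¹ * y) =
      conj (weightChar' W q g g' eP' eM' w κ) * projTest W q g g' eP' eM' ν K νK f y :=
  biProjList_apply_inv_mul _ hgood hcomm f (placeDatum_mem W q g g' eP' eM' ν K νK w) y hκ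

/-- Right-equivariance at `w` (the weight itself): `f₁ (z κ) = weight′ κ · f₁ z`. -/
theorem projTest_apply_mul (hgood : ∀ d ∈ projData W q g g' eP' eM' ν K νK, d.Good)
    (hcomm : (projData W q g g' eP' eM' ν K νK).Pairwise ProjDatum.Commutes) (f : GA W → ℂ) (w : InfinitePlace k)
    (z : GA W) {κ : GA W} (hκ : κ ∈ localTorusAt' W w) :
    projTest W q g g' eP' eM' ν K νK f (z * κ) =
      weightChar' W q g g' eP' eM' w κ * projTest W q g g' eP' eM' ν K νK f z := by
  have h := biProjList_apply_mul _ hgood hcomm f (placeDatum_mem W q g g' eP' eM' ν K νK w) z hκ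
  simpa only [projTest, placeDatum, Complex.conj_conj] using h

/-- Left `K`-invariance (inverse form). -/
theorem projTest_apply_inv_mul_K (hgood : ∀ d ∈ projData W q g g' eP' eM' ν K νK, d.Good)
    (hcomm : (projData W q g g' eP' eM' ν K νK).Pairwise ProjDatum.Commutes) (f : GA W → ℂ) (y : GA W) {κ : GA W}
    (hκ : κ ∈ K) :
    projTest W q g g' eP' eM' ν K νK f (κ⁻¹ * y) = projTest W q g g' eP' eM' ν K νK f y := by
  have h := biProjList_apply_inv_mul _ hgood hcomm f (levelDatum_mem W q g g' eP' eM' ν K νK) y hκ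
  simpa only [projTest, levelDatum, one_mul] using h

/-- Right `K`-invariance. -/
theorem projTest_apply_mul_K (hgood : ∀ d ∈ projData W q g g' eP' eM' ν K νK, d.Good)
    (hcomm : (projData W q g g' eP' eM' ν K νK).Pairwise ProjDatum.Commutes) (f : GA W → ℂ) (z : GA W) {κ : GA W}
    (hκ : κ ∈ K) :
    projTest W q g g' eP' eM' ν K νK f (z * κ) = projTest W q g g' eP' eM' ν K νK f z := by
  have h := biProjList_apply_mul _ hgood hcomm f (levelDatum_mem W q g g' eP' eM' ν K νK) z hκ
  simpa only [projTest, levelDatum, map_one, one_mul] using h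

variable (R : RTFData W) (μ : Measure (GA W)) [μ.IsHaarMeasure] [R.μT.IsHaarMeasure] [R.μT'.IsHaarMeasure]
  (DG : Set (GA W)) (fdG : IsFundamentalDomain (rationalPoints W) DG μ) (compG : IsCompact (closure DG))
  (compT : IsCompact (closure R.DT)) (compT' : IsCompact (closure R.DT'))

/-- **STABILITY `hst₁`**: `R(cj f₁) φ ∈ kTypeSpace' … K V` for `f₁ := projTest f`, every invariant `V`, every `φ ∈ V`. -/
theorem rightRegular_cj_projTest_mem (hgood : ∀ d ∈ projData W q g g' eP' eM' ν K νK, d.Good)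
    (hcomm : (projData W q g g' eP' eM' ν K νK).Pairwise ProjDatum.Commutes) {V : Submodule ℂ (GA W → ℂ)}
    (hV : (Setting.ofAdelicData W R μ DG fdG compG compT compT').IsInvariantSubspace (V : Set (GA W → ℂ)))
    {f : GA W → ℂ} (hf : IsTestFn W f) {φ : GA W → ℂ} (hφ : φ ∈ V) :
    rightRegular W μ (RTF.cj (projTest W q g g' eP' eM' ν K νK f)) φ ∈ kTypeSpace' W q g g' eP' eM' K V := by
  have ht : RTF.IsTest (projTest W q g g' eP' eM' ν K νK f) :=
    ⟨(isTestFn_projTest W q g g' eP' eM' ν K νK hgood hf).1, (isTestFn_projTest W q g g' eP' eM' ν K νK hgood hf).2⟩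
  refine rightRegular_mem_kTypeSpace' W R μ DG fdG compG compT compT' q g g' eP' eM' K V hV
    ⟨(RTF.IsTest.cj ht).cont, (RTF.IsTest.cj ht).compact⟩ ?_ ?_ hφ
  · intro w κ hκ y
    simp only [RTF.cj]
    rw [projTest_apply_inv_mul W q g g' eP' eM' ν K νK hgood hcomm f w y hκ, map_mul, Complex.conj_conj]
    rfl
  · intro κ hκ y
    simp only [RTF.cj]
    rw [projTest_apply_inv_mul_K W q g g' eP' eM' ν K νK hgood hcomm f y hκ]

/-- **STABILITY `hst₂`**: `R(refl f₂) φ ∈ kTypeSpace' … K V` for `f₂ := projTest f'`, every invariant `V`, every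
`φ ∈ V`. -/
theorem rightRegular_refl_projTest_mem (hgood : ∀ d ∈ projData W q g g' eP' eM' ν K νK, d.Good)
    (hcomm : (projData W q g g' eP' eM' ν K νK).Pairwise ProjDatum.Commutes) {V : Submodule ℂ (GA W → ℂ)}
    (hV : (Setting.ofAdelicData W R μ DG fdG compG compT compT').IsInvariantSubspace (V : Set (GA W → ℂ)))
    {f' : GA W → ℂ} (hf' : IsTestFn W f') {φ : GA W → ℂ} (hφ : φ ∈ V) :
    rightRegular W μ (RTF.refl (projTest W q g g' eP' eM' ν K νK f')) φ ∈ kTypeSpace' W q g g' eP' eM' K V := by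
  have ht : RTF.IsTest (projTest W q g g' eP' eM' ν K νK f') :=
    ⟨(isTestFn_projTest W q g g' eP' eM' ν K νK hgood hf').1,
      (isTestFn_projTest W q g g' eP' eM' ν K νK hgood hf').2⟩
  refine rightRegular_mem_kTypeSpace' W R μ DG fdG compG compT compT' q g g' eP' eM' K V hV
    ⟨(RTF.IsTest.refl ht).cont, (RTF.IsTest.refl ht).compact⟩ ?_ ?_ hφ
  · intro w κ hκ y
    simp only [RTF.refl, mul_inv_rev, inv_inv]
    exact projTest_apply_mul W q g g' eP' eM' ν K νK hgood hcomm f' w y⁻¹ hκ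
  · intro κ hκ y
    simp only [RTF.refl, mul_inv_rev, inv_inv]
    exact projTest_apply_mul_K W q g g' eP' eM' ν K νK hgood hcomm f' y⁻¹ hκ

end Stability

end Summit.Ventures.HodgeRepro.Tier4.Line4

end
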